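import Literature.NumberTheory.EllipticCurves.KuriharaNumber
import Literature.NumberTheory.EllipticCurves.KatoKolyvaginPrimes
import Literature.NumberTheory.EllipticCurves.CuspFormLFunction
import Literature.NumberTheory.EllipticCurves.KuriharaNumberKimCertificate
import Literature.NumberTheory.EllipticCurves.BSDSelmer
import Literature.NumberTheory.EllipticCurves.NonEisensteinPrimeOfSurjective
import HarnessLib
import Literature.NumberTheory.EllipticCurves.KuriharaNumberKimStructure

/-!
# Crux `SelmerRankLB` (stmt-BirchSwinnertonDyer-0131), line `kurihara_order` — stub V2a `stub_delta_prime_of_odd_rank`, closed modulo its printed inputs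

The registered stub V2a of the skeleton `Cruxes/SelmerRankLB/Lines/kurihara_order.lean`
(`Summit.BirchSwinnertonDyer.BirchSwinnertonDyer.Cruxes.SelmerRankLB.KuriharaOrder.stub_delta_prime_of_odd_rank`):
for `E/ℚ` with globally minimal model `W`, a prime `p ≥ 5` of good ordinary reduction with
`ρ̄_{E,p}` surjective, the newform `f` of `W` at level `N_E`, a level `k ≥ 1`, a Kolyvagin PRIME
`n = ℓ ∈ 𝒫_k` (`n ∈ 𝒩_k` with `ν(n) = 1`), surjective discrete logarithms `ψ`, and
`ord_{s=1} L(E, s)` ODD and `≥ 3`: the first-layer Kurihara number vanishes,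
`kuriharaNumber f (p^k) n ψ = 0` in `ℤ/p^k`.

This is TRUE in print, but its only known proof runs through Selmer groups (skeleton docstring):
if `δ̃_ℓ^{(k)} ≠ 0` then `corank_{ℤ_p} Sel_{p^∞}(E/ℚ) = ord(δ̃) ≤ ν(ℓ) = 1` (C.-H. Kim 2022,
Thm. 1.9 (1)); `corank ≡ ord_{s=1} L(E, s) (mod 2)` is odd (the `p`-parity theorem,
Dokchitser–Dokchitser 2010, tree fact `selmerCorank_mod_two_eq`), so `corank = 1`; the corank-one
`p`-converse WITHOUT ramification hypothesis (Yan–Zhu, Cor. 1.4 = arXiv:2412.20078;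
Burungale–Castella–Grossi–Skinner, Camb. J. Math. 14 (2026), Cor. 1, over an auxiliary imaginary
quadratic field) gives `ord_{s=1} L(E, s) = 1`, contradicting `3 ≤ ord`. None of Kim's structure
theorem, the `p`-parity theorem or the `p`-converse is provable in a session (XL literature leaf),
so this file lands the stub RELATIVE to them, as the `--supports` helper (colon form, registered as
a sub-goal of the crux item by `ledger workitem stub-add`)
`stub_delta_prime_of_odd_rank_of_facts : F3 → F4 → hpar → hper → <stub statement verbatim>`, with

* F3 `Literature.NumberTheory.EllipticCurves.Kim2022_selmerCorank_le_of_kuriharaNumber_ne_zero`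
  (NEW named fact, stated inline below for relocation to
  `Literature/NumberTheory/EllipticCurves/KuriharaNumberKimStructure.lean`): Kim 2022 Thm. 1.9 (1),
  UPPER direction, in the tree's `Ω⁺_f`-normalisation — a non-zero `kuriharaNumber f (p^k) n ψ`
  at `n ∈ 𝒩_k` bounds `corank_{ℤ_p} Sel_{p^∞}(E/ℚ) ≤ ν(n)`;
* F4 `Literature.NumberTheory.EllipticCurves.yanZhu_analyticRank_eq_one_of_selmerCorank_eq_one`
  (NEW named fact, inline; the gate relocates both facts of one proposal to the first file hint,
  `KuriharaNumberKimStructure.lean`): the corank-one `p`-converse at a good ordinary `p ≥ 5` with `ρ̄_{E,p}` surjective and NO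
  hypothesis (ram) — the tree's `burungaleSkinnerTianWan_analyticRank_eq_one_of_selmerCorank_eq_one`
  (`BSDSelmer.lean`) carries (ram), which the stub does not have;
* `hpar` — the tree's EXISTING named fact `selmerCorank_mod_two_eq W p` (unproved), universally
  quantified over elliptic `W/ℚ` and primes `p` as in `BSDSelmerCMPConverseRankOneProofs`;
* `hper` — the period-transfer statement `Ω(W) = u · Ω⁺_f`, `u ∈ ℚ`, `|u|_p = 1` at a good `p ≥ 5`
  with `E[p]` irreducible, written LITERALLY as a `Prop` hypothesis (the sibling stub K of this
  line states it as the named fact `realPeriodRat_eq_unit_mul_plusPeriod`; it is not re-declared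
  here). It feeds F3's explicit period hypothesis (the normalisation clause of
  `Kim2022_kuriharaNumber_certificate`, file `KuriharaNumberKimCertificate`).

Proof of the helper (≤ 15 lines): irreducibility from surjectivity
(`hasIrreducibleModPGaloisRep_of_hasSurjectiveModNGaloisRep`), `hper` gives the unit `u`, F3 gives
`corank ≤ ν(n) = 1`, `hpar` and `Odd ord` give `corank % 2 = 1`, so `corank = 1`, F4 gives
`ord = 1`, and `omega` closes against `3 ≤ ord`. The arithmetic core is isolated as
`deltaPrime_analyticRank_eq_one_of_selmerCorank_le_one` (pointwise, reusable by stub V2b).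

## Hypothesis audit of the two new facts (sources held: `lit read arxiv:2203.12159`,
## `lit read arxiv:2412.20078`, `lit read arxiv:2312.09301`)

F3. Kim, arXiv:2203.12159 = Amer. J. Math. (2026), PDF pp. 7–8, verbatim. §1.4.3: "For each
`n ∈ 𝒩_1`, the (mod `I_n`) Kurihara number at `n` is defined by
`δ̃_n = Σ_{a ∈ (ℤ/nℤ)ˣ} \overline{[a/n]⁺} · Π_{ℓ ∣ n} \overline{log_{η_ℓ}(a)} ∈ ℤ_p/I_nℤ_p` …
`δ̃_n` is well-defined up to `(ℤ_p/I_nℤ_p)ˣ`. When `n ∈ 𝒩_k`, we write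
`δ̃_n^{(k)} = δ̃_n mod p^k ∈ ℤ/p^kℤ`." §1.4.4: "The vanishing order of `δ̃` is defined by
`ord(δ̃) = min{ν(n) : n ∈ 𝒩_1, δ̃_n ≠ 0}`. We write `ord(δ̃) = ∞` if `δ̃_n = 0` for all `n ∈ 𝒩_1`."
THEOREM 1.9: "Let `E` be an elliptic curve over `ℚ` and `p ≥ 5` a prime such that `ρ̄` is
surjective and the Manin constant is prime to `p`. If `ord(δ̃) < ∞`, then
(1) `cork_{ℤ_p} Sel(ℚ, E[p^∞]) = ord(δ̃)`, i.e. `Fitt_{i,ℤ_p}(Sel(ℚ, E[p^∞])^∨) = 0` for all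
`0 ≤ i ≤ ord(δ̃) − 1`, (2) …, (3) …". DEDUCTION of F3: for `n ∈ 𝒩_k` one has `I_n ⊆ p^kℤ_p`
(`ℓ ∈ 𝒫_k`: `p^k ∣ ℓ − 1`, `p^k ∣ a_ℓ − ℓ − 1`), so `δ̃_n^{(k)} ≠ 0 ⇒ δ̃_n ≠ 0 (mod I_n)`, whence
`ord(δ̃) ≤ ν(n) < ∞` is witnessed by `n` itself and (1) gives `cork = ord(δ̃) ≤ ν(n)` — neither the
main conjecture nor ordinarity is used for this direction (contrast stub K / Cor. 1.6); the
hypotheses "good at `p`, `p ∤ a_p`" are kept to match the crux and make F3 weaker, not stronger.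
(i) `ρ̄` surjective, `p ≥ 5`: verbatim. (ii) "the Manin constant is prime to `p`": automatic here —
`p ∤ N` (good reduction) gives `p ∤ c₀` for the `X₀(N)`-optimal curve `E₀` (Abbes–Ullmo 1996,
Thm. A, tree fact `abbesUllmo_not_dvd_maninConstant_of_not_dvd_level`; Mazur 1978, Cor. 4.1 for odd
`p`), and since `E[p]` is irreducible an isogeny `E₀ → E` of minimal degree has degree prime to `p`
(else it factors through `[p]`), is étale at the good prime `p`, and multiplies Néron differentials
by a `p`-unit; so the minimal parametrisation of `E` has Manin constant prime to `p` (the paper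
itself, after Cor. 1.6, p. 6: "The Manin constant is not divisible by a prime `p ≥ 3` if `E` has
semi-stable reduction at `p` [Mazur]. Thus, the Manin constant assumption is needed only when `E`
has additive reduction at `p`.").
(iii) PERIODS: Kim's `[r]⁺ = Re{∞, r}_f/Ω⁺_E` with `Ω⁺_E` "the absolute value of the integral of an
invariant differential of a global minimal Weierstrass model of `E` over `E(ℝ)`" (§1.4.1) =
`W.realPeriodRat` (`[W.IsGloballyMinimal]`), whereas the tree's `ratPlusSymbol f r = Re{∞, r}_f/Ω⁺_f`
(`Ω⁺_f = plusPeriod f`); under the explicit hypothesis `Ω(W) = u·Ω⁺_f`, `|u|_p = 1`,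
`ratPlusSymbol f r = u·[r]⁺` with both sides `p`-integral (`IsNewformOf.norm_ratPlusSymbol_le_one`),
so `kuriharaNumber f (p^k) n (log mod p^k) = ū·δ̃_n^{(k)}` with `ū ∈ (ℤ/p^k)ˣ` — exactly the
normalisation clause of `Kim2022_kuriharaNumber_certificate`. (iv) LOGARITHMS: Kim fixes primitive
roots; F3 asks the `ψ_ℓ` to be surjective, and two surjective choices change `kuriharaNumber` by a
unit (`kuriharaNumber_eq_zero_iff_of_surjective`). (v) LEVEL: `IsNewformOf W f` at level `N` forces
`N = N_E` (Carayol; tree fact `IsNewformOf.level_eq_conductorNorm`), Kim's `f`; `𝒩_k` is Kim's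
(`Kato.IsKolyvaginProduct`, conductor `W.conductorNorm ℤ`, `a_ℓ = W.frobeniusTrace ℓ`).
With (i)–(v) F3 is WEAKER than the printed Thm. 1.9 (1) ∘ [Abbes–Ullmo + prime-to-`p` isogeny],
never stronger.

F4. Yan–Zhu, *Main conjectures for non-CM elliptic curves at good ordinary primes*,
arXiv:2412.20078 = J. Algebra (2026), doi:10.1016/j.jalgebra.2026.01.016. Abstract, verbatim:
"Let `E/ℚ` be an elliptic curve and `p > 2` be a prime of good ordinary reduction for `E`. Assume
that the residue representation associated with `(E, p)` is irreducible. In this paper, we prove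
more cases on several Iwasawa main conjectures for `E`. As applications, we prove more general
cases of `p`-converse theorem and `p`-part BSD formula when the rank is less than or equal to `1`."
COROLLARY 1.4 (§1.1, p. 3 of the held text), verbatim: "Let `E/ℚ` be an elliptic curve of
conductor `N`, `p ∤ 2N` a prime. Assume that `E` has ordinary reduction at `p`, if `r ≤ 1`, the
following are equivalent
• `corank_{ℤ_p} Sel_{p^∞}(E/ℚ) = r`, • `ord_{s=1} L(E/ℚ, s) = r`." (= Thm. 4.15 of §4.6, whose
proof of (2) ⇒ (3) chooses an imaginary quadratic `K` with the Heegner hypothesis and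
`ord_{s=1} L(E^K, s) ≤ 1` by Friedberg–Hoffstein and descends Thm. 4.12 (2):
"`corank_{ℤ_p} Sel_{p^∞}(E/K) = 1` implies `ord_{s=1} L(E/K, s) = 1`".) The same `K`-statement is
Burungale–Castella–Grossi–Skinner, Camb. J. Math. 14 (2026) = arXiv:2312.09301, Cor. 1 (p. 4),
verbatim: "For `E`, `p` and `K` as in Theorem 1 [`p` odd good ordinary, `K` with (Heeg), (disc),
(tor), `p` split in `K`, the rational anticyclotomic Main Conjecture — in particular if `p > 3`
satisfies (irr)], we have `ord(κ^{Heeg}) = max{r(E/K)⁺, r(E/K)⁻} − 1`. … In the rank one case it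
yields a `p`-converse to the Gross–Zagier and Kolyvagin theorem:
`corank_{ℤ_p} Sel_{p^∞}(E/K) = 1 ⟹ ord_{s=1} L(E/K, s) = 1`". TRANSCRIPTION of Cor. 1.4,
(2) ⇒ (3), `r = 1`, under the crux's (stronger) hypotheses: `W` globally minimal (to read `a_p`);
`5 ≤ p` (⇒ `p ∤ 2`); good reduction at `p` (⇒ `p ∤ N`,
`WeierstrassCurve.dvd_conductorNorm_iff_not_hasGoodReductionAtPrime`); `p ∤ a_p` (ordinary);
`ρ̄_{E,p}` surjective (⇒ irreducible, `hasIrreducibleModPGaloisRep_of_hasSurjectiveModNGaloisRep`;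
⇒ non-CM, the paper's title: for `E` with CM by an order `𝒪`, `ρ̄_{E,p}(G_ℚ)` normalises
`ρ̄_{E,p}(G_K) ⊆ (𝒪/p)ˣ`, so has order `≤ 2(p² − 1) < #GL₂(𝔽_p)` once `p ≥ 3`;
⇒ `ρ̄|_{G_K}` absolutely irreducible for every quadratic `K`, as an index-`≤ 2` subgroup of
`GL₂(𝔽_p)` contains the commutator subgroup `SL₂(𝔽_p)` for `p ≥ 3`);
`W.selmerCorank p = 1`; conclusion `W.analyticRank = 1`. WEAKER than print.
-/

set_option linter.dupNamespace false

noncomputable section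

open scoped MatrixGroups ModularForm Classical

open CongruenceSubgroup

open Literature.NumberTheory.EllipticCurves

open Literature.NumberTheory.EllipticCurves.ModularForms

/-! ### The two named facts (stated in the Literature namespace, every constant fully qualified so
that the gate's relocated copy elaborates without this file's `open`s; relocated by the gate) -/

namespace Literature.NumberTheory.EllipticCurves

end Literature.NumberTheory.EllipticCurves

/-! ### The stub, relative to F3, F4, `p`-parity and the period transfer -/

namespace Summit.BirchSwinnertonDyer.BirchSwinnertonDyer.Theorems

/-- **Arithmetic core of stub V2a** (pointwise). For an elliptic curve `E/ℚ` and a prime `p`: if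
`corank_{ℤ_p} Sel_{p^∞}(E/ℚ) ≡ ord_{s=1} L(E, s) (mod 2)` (`hpar`, the `p`-parity theorem for this
curve and prime, tree fact `selmerCorank_mod_two_eq W p`), the corank-one `p`-converse holds for
this curve and prime (`hconv`), `corank ≤ 1` and `ord_{s=1} L(E, s)` is odd, then
`ord_{s=1} L(E, s) = 1`: the corank is odd and `≤ 1`, hence `1`, and the converse applies.
[folklore] -/
theorem deltaPrime_analyticRank_eq_one_of_selmerCorank_le_one (W : WeierstrassCurve ℚ)
    [W.IsElliptic] (p : ℕ) [Fact p.Prime] (hpar : selmerCorank_mod_two_eq W p)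
    (hconv : W.selmerCorank p = 1 → W.analyticRank = 1) (hle : W.selmerCorank p ≤ 1)
    (hodd : Odd W.analyticRank) : W.analyticRank = 1 := by
  have hmod : W.selmerCorank p % 2 = W.analyticRank % 2 := hpar
  have hodd' : W.analyticRank % 2 = 1 := Nat.odd_iff.mp hodd
  exact hconv (by omega)

/-- **No odd analytic rank `≥ 3` under a corank bound `≤ 1`** (pointwise contrapositive form used by
the stub): with `hpar`, `hconv` as in `deltaPrime_analyticRank_eq_one_of_selmerCorank_le_one`, an odd
`ord_{s=1} L(E, s) ≥ 3` forces `2 ≤ corank_{ℤ_p} Sel_{p^∞}(E/ℚ)`. [folklore] -/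
theorem deltaPrime_two_le_selmerCorank_of_odd_of_three_le (W : WeierstrassCurve ℚ) [W.IsElliptic]
    (p : ℕ) [Fact p.Prime] (hpar : selmerCorank_mod_two_eq W p)
    (hconv : W.selmerCorank p = 1 → W.analyticRank = 1) (hodd : Odd W.analyticRank)
    (h3 : 3 ≤ W.analyticRank) : 2 ≤ W.selmerCorank p := by
  by_contra hlt
  have h1 := deltaPrime_analyticRank_eq_one_of_selmerCorank_le_one W p hpar hconv (by omega) hodd
  omega

/-- **Stub V2a (`stub_delta_prime_of_odd_rank`) closed MODULO its printed inputs.** Hypotheses: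
`hF3` = Kim 2022, Thm. 1.9 (1), upper direction (`Kim2022_selmerCorank_le_of_kuriharaNumber_ne_zero`);
`hF4` = the corank-one `p`-converse without (ram) (`yanZhu_analyticRank_eq_one_of_selmerCorank_eq_one`);
`hpar` = the `p`-parity theorem for all elliptic `E/ℚ` and primes `p` (tree fact
`selmerCorank_mod_two_eq`, Dokchitser–Dokchitser 2010, Thm. 1.4); `hper` = the period transfer
`Ω(W) = u·Ω⁺_f` with `u ∈ ℚ` a `p`-adic unit at a good `p ≥ 5` with `E[p]` irreducible, for the
newform `f` of `W` (stated by stub K of this line as the named fact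
`realPeriodRat_eq_unit_mul_plusPeriod`; written out here). Consequent: the registered signature of
`stub_delta_prime_of_odd_rank`, verbatim. Colon form (all binders after the colon; the header is
registered by `ledger workitem stub-add` as a sub-goal of the crux item so that `--supports`
matches it by name and signature). Proof: were `kuriharaNumber f (p^k) n ψ ≠ 0` at the Kolyvagin
prime `n` (`ν(n) = 1`), F3 (with the unit of `hper`, irreducibility from surjectivity) would give
`corank ≤ 1`, while parity, F4 and `ord` odd `≥ 3` give `corank ≥ 2`
(`deltaPrime_two_le_selmerCorank_of_odd_of_three_le`).
[cite: Kim2022StructureSelmer, Thm. 1.9 (1) (PDF p. 7)] [cite: YanZhu2024MainConjNonCM, Cor. 1.4]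
[cite: BurungaleEtAl2026, Cor. 1] [cite: DokchitserDokchitserAnnals2010, Thm. 1.4] -/
theorem stub_delta_prime_of_odd_rank_of_facts :
    Literature.NumberTheory.EllipticCurves.Kim2022_selmerCorank_le_of_kuriharaNumber_ne_zero →
    Literature.NumberTheory.EllipticCurves.yanZhu_analyticRank_eq_one_of_selmerCorank_eq_one →
    (∀ (W : WeierstrassCurve ℚ) [W.IsElliptic] (p : ℕ) [Fact p.Prime],
      Literature.NumberTheory.EllipticCurves.selmerCorank_mod_two_eq W p) →
    (∀ (W : WeierstrassCurve ℚ) [W.IsElliptic] [W.IsGloballyMinimal] (p : ℕ) [Fact p.Prime],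
      5 ≤ p → W.HasGoodReductionAtPrime p → W.HasIrreducibleModPGaloisRep p →
      ∀ {N : ℕ} [NeZero N] (f : CuspForm (Gamma0 N) 2), IsNewformOf W f →
      ∃ u : ℚ, ‖(u : ℚ_[p])‖ = 1 ∧ W.realPeriodRat = u * plusPeriod f) →
    ∀ (W : WeierstrassCurve ℚ) [W.IsElliptic] [W.IsGloballyMinimal] (p : ℕ) [Fact p.Prime],
      5 ≤ p → W.HasGoodReductionAtPrime p → ¬ (p : ℤ) ∣ W.frobeniusTrace p →
      W.HasSurjectiveModNGaloisRep p →
      ∀ (_ : NeZero (W.conductorNorm ℤ)) (f : CuspForm (Gamma0 (W.conductorNorm ℤ)) 2),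
        IsNewformOf W f →
        ∀ (k n : ℕ) [NeZero n], 1 ≤ k → Kato.IsKolyvaginProduct W p k n → n.primeFactors.card = 1 →
          Odd W.analyticRank → 3 ≤ W.analyticRank →
          ∀ ψ : (ℓ : ℕ) → (ZMod ℓ)ˣ →* Multiplicative (ZMod (p ^ k)),
            (∀ ℓ ∈ n.primeFactors, Function.Surjective (ψ ℓ)) →
            kuriharaNumber f (p ^ k) n ψ = 0 := by
  intro hF3 hF4 hpar hper W _ _ p _ h5 hgood hord hsurj hN f hf k n _ hk hn hν hodd h3 ψ hψ
  by_contra hne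
  haveI := hN
  have hirr : W.HasIrreducibleModPGaloisRep p :=
    hasIrreducibleModPGaloisRep_of_hasSurjectiveModNGaloisRep W p hsurj
  -- F3: a non-zero first-layer Kurihara number bounds the corank by `ν(n) = 1`
  have hle : W.selmerCorank p ≤ 1 :=
    hν ▸ hF3 W p h5 hgood hord hsurj f hf (hper W p h5 hgood hirr f hf) k n hk hn ψ hψ hne
  -- parity + F4 + `ord` odd `≥ 3`: the corank is at least `2`
  have h2 : 2 ≤ W.selmerCorank p :=
    deltaPrime_two_le_selmerCorank_of_odd_of_three_le W p (hpar W p) (hF4 W p h5 hgood hord hsurj)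
      hodd h3
  omega

end Summit.BirchSwinnertonDyer.BirchSwinnertonDyer.Theorems

end
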